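import Summits.BirchSwinnertonDyer.BirchSwinnertonDyer.Theorems.PrintCf2RubinValueTwoAvatarOnRaySubgroup
import Summits.BirchSwinnertonDyer.BirchSwinnertonDyer.Theorems.PrintCf2RubinValueTwoEllipticUnitsLocalSeamDegreeOne
import HarnessLib

/-!
# The avatar on the ray subgroup at a place of DEGREE ONE: `ε̂(σ) ≡ (e_p(κσ))^{pp w₀} (mod p^N)` —
# the one-variable stand-in read in `ℤ_p` (de Shalit 1987, II.4.14 (38): "`ε ≡ λ^k` on `G_n`")

Cell `bsd-print-cf2`, width seat `bsd-line-cf2-p1-w5` g13; construction lane of the print leaf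
`KatzDistributionsAtTwoPrint` (stmt-24720) of crux `PrintCf2.SplitBadTwoRankOneOfFacts` (stmt-20368).
Theorems only; no `sorry`. BSD is not proved by any of this; nothing is closed by this file.

`PrintCf2RubinValueTwoAvatarOnRaySubgroup.lean` proves, for any totally complex `K`, that on
`Gal(K̄/K(𝔪))` the `p`-adic avatar of an algebraic Hecke character `ε` of infinity type `(pp, qq)` is
within `p^{−N}` of the algebraic character `Λ(⟨κσ⟩_v)⁻¹ = ∏_{emb : K_v → ℚ̄_p} emb(κσ)^{n_emb}` of the
`v`-adic Artin character `κ`. THIS FILE reads that character at a place `v` of DEGREE ONE over `p`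
(`e(v|p) = f(v|p) = 1`, the lane's split `p = v v̄` in an imaginary quadratic field):

* `subsingleton_continuousEmb_of_degree_one` — `K_v` has exactly one continuous embedding into `ℚ̄_p`,
  namely `ℚ_p ⊆ ℚ̄_p` after `padicEquivOfDegreeOne` (cf. `EllipticUnitsLocal.Seam.ringHom_eq_ringHom_of_continuous`);
* `coe_algPart_inv_localUnits_of_degree_one` — `Λ(⟨u⟩_v)⁻¹ = ι_{ℚ̄_p}(e_p u)^{n₀}` with
  `e_p = padicIntEquivOfDegreeOne : 𝒪_v ≃+* ℤ_p` and `n₀` the exponent of the unique embedding;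
* `comp_eq_of_place_eq`, `embExponent_eq_of_place` — if `v` is THE place of `ι⁻¹ ∘ τ` for a complex
  embedding `τ : K → ℂ` (`∀ d, d ∈ v ↔ ‖ι⁻¹(τ d)‖ < 1`, the frame hypothesis of the lane for `τ = σ_{w₀}`),
  then `ι ∘ emb₀ ∘ ι_v = τ`, so `n₀ = embExponent pp qq τ`; and `embExponent pp qq σ_{w₀} = pp w₀`
  (`embExponent_embedding`);
* ★ `norm_avatarValueAt_sub_padicIntCast_zpow_le` — **`‖ε̂(σ) − (e_p(κσ) : ℂ_p)^{pp w₀}‖ ≤ p^{−N}` on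
  `Gal(K̄/K(𝔪))`**, in the lane's currency `padicIntCast ℂ_[p]`: for `pp = −m` this is de Shalit's
  replacement of `ε` by the monomial `λ^k` (`m = k + 1` in the numbering of
  `EllipticUnitsLocal.integral_character_pow_succ_ellipticUnitsLocal`, whose character is `(e₂ ∘ κ)⁻¹`
  to the power `k + 1`);
* ★ `exists_const_forall_norm_avatarValueAt_sub_le` — the `∃ C ≥ 0, ∀ M, ∀ σ ∈ Gal(K̄/K(𝔪_M))` clause of
  the R220-CUT's `AvatarMonomialCongruence` for one in-range `ε` along any family of moduli `𝔪_M` deep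
  enough above `p` at depth `p^{M+1}` and eventually divisible by the module of definition (`C = 2·p^{M₀}`).

## References

* [deShalit1987] E. de Shalit, *Iwasawa theory of elliptic curves with complex multiplication* (1987),
  II.1.1 (p. 32), II.4.13 (p. 69), II.4.14 (38) (p. 72).
* [SerreAbelianLadic1968] J.-P. Serre, *Abelian ℓ-adic representations and elliptic curves* (1968),
  Ch. III §1.1, §2.3.
* [FrohlichTaylor1990] A. Fröhlich, M. J. Taylor, *Algebraic Number Theory*, Ch. III §1 (1.14)(a).
-/

noncomputable section

namespace Summit.BirchSwinnertonDyer.BirchSwinnertonDyer.Theorems.PrintCf2.AvatarOnRay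

open scoped NumberField Topology nonZeroDivisors
open NumberField IsDedekindDomain IsDedekindDomain.HeightOneSpectrum Field
open Literature.NumberTheory.EllipticCurves Literature.NumberTheory.GaloisRepresentations
open Literature.NumberTheory.NumberFields

set_option linter.dupNamespace false -- D-0017: single-problem summit, `…BirchSwinnertonDyer.BirchSwinnertonDyer…` repeats a namespace by design
set_option autoImplicit false

variable {p : ℕ} [hp : Fact p.Prime] {K : Type} [Field K] [NumberField K]

/-! ### §1. The unique continuous embedding `K_v → ℚ̄_p` at degree one, and `Λ(⟨u⟩_v)⁻¹` read in `ℤ_p` -/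

section DegreeOne

variable (ι : PadicAlgCl p ≃+* ℂ) (pp qq : InfinitePlace K → ℤ) {v : HeightOneSpectrum (𝓞 K)}
  [v.asIdeal.LiesOver (ratPlace p).asIdeal]
  (he : v.asIdeal.ramificationIdx (𝓞 ℚ) = 1) (hf : v.asIdeal.inertiaDeg (𝓞 ℚ) = 1)

/-- The canonical continuous embedding `K_v ≅ ℚ_p ⊆ ℚ̄_p` at a place of degree one is continuous.
[cite: FrohlichTaylor1990, Ch. III §1 (1.14)(a)] -/
theorem continuous_algebraMap_comp_padicEquivOfDegreeOne :
    Continuous ((algebraMap ℚ_[p] (PadicAlgCl p)).comp (padicEquivOfDegreeOne K p v he hf).toRingHom) :=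
  (continuous_algebraMap ℚ_[p] (PadicAlgCl p)).comp (continuous_padicEquivOfDegreeOne K p v he hf)

/-- **At degree one every continuous `K_v → ℚ̄_p` is `ℚ_p ⊆ ℚ̄_p` after `padicEquivOfDegreeOne`.**
[cite: FrohlichTaylor1990, Ch. III §1 (1.14)(a)] -/
theorem eq_algebraMap_comp_padicEquivOfDegreeOne
    (f : {e : v.adicCompletion K →+* PadicAlgCl p // Continuous e}) :
    f.1 = (algebraMap ℚ_[p] (PadicAlgCl p)).comp (padicEquivOfDegreeOne K p v he hf).toRingHom :=
  EllipticUnitsLocal.Seam.ringHom_eq_ringHom_of_continuous K p v he hf _ _ f.2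
    (continuous_algebraMap_comp_padicEquivOfDegreeOne he hf)

include he hf in
/-- **`K_v` has exactly one continuous embedding into `ℚ̄_p` at degree one.**
[cite: FrohlichTaylor1990, Ch. III §1 (1.14)(a)] -/
theorem subsingleton_continuousEmb_of_degree_one :
    Subsingleton {e : v.adicCompletion K →+* PadicAlgCl p // Continuous e} :=
  ⟨fun a b => Subtype.ext (EllipticUnitsLocal.Seam.ringHom_eq_ringHom_of_continuous K p v he hf _ _ a.2 b.2)⟩

/-- ★ **`Λ(⟨u⟩_v)⁻¹` read in `ℤ_p` at degree one**: for `u ∈ 𝒪_vˣ`,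
`Λ(⟨u⟩_v)⁻¹ = ι_{ℚ̄_p}(e_p u)^{n₀}` where `e_p = padicIntEquivOfDegreeOne K p v : 𝒪_v ≃+* ℤ_p` and `n₀` is the
exponent in the type `(pp, qq)` of the unique continuous embedding `K_v → ℚ̄_p`.
[cite: SerreAbelianLadic1968, Ch. III §1.1] [cite: FrohlichTaylor1990, Ch. III §1 (1.14)(a)] -/
theorem coe_algPart_inv_localUnits_of_degree_one (hvp : ((p : ℕ) : 𝓞 K) ∈ v.asIdeal)
    (u : (v.adicCompletionIntegers K)ˣ) :
    (((PadicEmbedding.algPart ι pp qq (localUnits v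
        (Units.map ((v.adicCompletionIntegers K).subtype : _ →* _) u)))⁻¹ : (PadicAlgCl p)ˣ) : PadicAlgCl p) =
      algebraMap ℚ_[p] (PadicAlgCl p)
          ((padicIntEquivOfDegreeOne K p v he hf (u : v.adicCompletionIntegers K) : ℤ_[p]) : ℚ_[p]) ^
        HeckeCharacter.embExponent pp qq ((ι : PadicAlgCl p →+* ℂ).comp
          (((algebraMap ℚ_[p] (PadicAlgCl p)).comp (padicEquivOfDegreeOne K p v he hf).toRingHom).comp
            (algebraMap K (v.adicCompletion K)))) := by
  classical
  haveI := subsingleton_continuousEmb_of_degree_one (p := p) (v := v) he hf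
  rw [coe_algPart_inv_localUnits_eq_prod ι pp qq hvp u,
    Fintype.prod_subsingleton _ (⟨(algebraMap ℚ_[p] (PadicAlgCl p)).comp
      (padicEquivOfDegreeOne K p v he hf).toRingHom, continuous_algebraMap_comp_padicEquivOfDegreeOne he hf⟩ :
        {e : v.adicCompletion K →+* PadicAlgCl p // Continuous e})]
  congr 1
  change algebraMap ℚ_[p] (PadicAlgCl p) (padicEquivOfDegreeOne K p v he hf
    ((u : v.adicCompletionIntegers K) : v.adicCompletion K)) = _
  rw [← coe_padicIntEquivOfDegreeOne_apply]

/-! ### §2. Pinning the exponent: `v` is the place of `ι⁻¹ ∘ τ` -/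

omit [v.asIdeal.LiesOver (ratPlace p).asIdeal] in
/-- The place of an `ℓ`-adic embedding is read off the unit ball: if `d ∈ v ↔ ‖τ' d‖ < 1` for all
`d ∈ 𝒪_K` then `place τ' = v`. [cite: SerreAbelianLadic1968, Ch. II §3.1] -/
theorem place_eq_of_forall_mem_iff {τ' : K →+* PadicAlgCl p}
    (h : ∀ d : 𝓞 K, d ∈ v.asIdeal ↔ ‖τ' (d : K)‖ < 1) : PadicEmbedding.place τ' = v := by
  refine HeightOneSpectrum.ext (Ideal.ext fun d => ?_)
  change d ∈ PadicEmbedding.ideal τ' ↔ _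
  rw [PadicEmbedding.mem_ideal_iff]
  exact (h d).symm

/-- A local embedding over `v` is the canonical one at degree one: `P.toEmbedding = emb₀ ∘ ι_v` for every
`P : PlaceEmb` above `v`. [cite: FrohlichTaylor1990, Ch. III §1 (1.14)(a)] -/
theorem toEmbedding_eq_of_fst_eq (P : PadicEmbedding.PlaceEmb K p)
    (hP : ((P.1 : {w : HeightOneSpectrum (𝓞 K) // ((p : ℕ) : 𝓞 K) ∈ w.asIdeal}) : HeightOneSpectrum (𝓞 K)) = v) :
    P.toEmbedding = ((algebraMap ℚ_[p] (PadicAlgCl p)).comp (padicEquivOfDegreeOne K p v he hf).toRingHom).comp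
      (algebraMap K (v.adicCompletion K)) := by
  obtain ⟨⟨v', hv'⟩, e, he'⟩ := P
  change v' = v at hP
  subst hP
  have h : e = (algebraMap ℚ_[p] (PadicAlgCl p)).comp (padicEquivOfDegreeOne K p v' he hf).toRingHom :=
    eq_algebraMap_comp_padicEquivOfDegreeOne he hf ⟨e, he'⟩
  subst h
  rfl

/-- **If `v` is the place of `ι⁻¹ ∘ τ` then `τ = ι ∘ emb₀ ∘ ι_v`** (`τ : K → ℂ` a complex embedding,
`emb₀` the unique continuous `K_v → ℚ̄_p` at degree one). [cite: SerreAbelianLadic1968, Ch. II §3.1, Ch. III §1.1] -/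
theorem comp_eq_of_place_eq (τ : K →+* ℂ) (hιv : ∀ d : 𝓞 K, d ∈ v.asIdeal ↔ ‖ι.symm (τ (d : K))‖ < 1) :
    (ι : PadicAlgCl p →+* ℂ).comp
        ((((algebraMap ℚ_[p] (PadicAlgCl p)).comp (padicEquivOfDegreeOne K p v he hf).toRingHom).comp
          (algebraMap K (v.adicCompletion K)))) = τ := by
  set τ' : K →+* PadicAlgCl p := ((ι.symm : ℂ ≃+* PadicAlgCl p) : ℂ →+* PadicAlgCl p).comp τ with hτ'
  have hpl : PadicEmbedding.place τ' = v := place_eq_of_forall_mem_iff (p := p) fun d => by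
    rw [hτ']; exact hιv d
  have hemb : τ' = ((algebraMap ℚ_[p] (PadicAlgCl p)).comp (padicEquivOfDegreeOne K p v he hf).toRingHom).comp
      (algebraMap K (v.adicCompletion K)) := by
    rw [← PadicEmbedding.PlaceEmb.toEmbedding_ofEmbedding τ']
    exact toEmbedding_eq_of_fst_eq he hf _ (by rw [PadicEmbedding.PlaceEmb.ofEmbedding_fst, hpl])
  rw [← hemb, hτ']
  ext a
  simp

/-- Hence the exponent of the unique local embedding at `v` is `embExponent pp qq τ`.
[cite: SerreAbelianLadic1968, Ch. III §1.1] -/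
theorem embExponent_eq_of_place (τ : K →+* ℂ) (hιv : ∀ d : 𝓞 K, d ∈ v.asIdeal ↔ ‖ι.symm (τ (d : K))‖ < 1) :
    HeckeCharacter.embExponent pp qq ((ι : PadicAlgCl p →+* ℂ).comp
        ((((algebraMap ℚ_[p] (PadicAlgCl p)).comp (padicEquivOfDegreeOne K p v he hf).toRingHom).comp
          (algebraMap K (v.adicCompletion K))))) = HeckeCharacter.embExponent pp qq τ := by
  rw [comp_eq_of_place_eq ι he hf τ hιv]

omit [NumberField K] hp in
/-- At a complex place the chosen embedding `σ_{w₀}` carries the exponent `pp w₀` (`K` totally complex).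
[cite: Weil1956, §1] -/
theorem embExponent_embedding [IsTotallyComplex K] (w₀ : InfinitePlace K) :
    HeckeCharacter.embExponent pp qq w₀.embedding = pp w₀ := by
  rw [HeckeCharacter.embExponent, if_neg (IsTotallyComplex.complexEmbedding_not_isReal _),
    InfinitePlace.mk_embedding, if_pos rfl]

end DegreeOne

/-! ### §3. The congruence in the lane's currency `padicIntCast ℂ_[p] (e_p (κσ)) ^ (pp w₀)` -/

section Lane

variable [IsTotallyComplex K] {ε : HeckeCharacter K} {pp qq : InfinitePlace K → ℤ}
  {T : Finset (HeightOneSpectrum (𝓞 K))} {em : HeightOneSpectrum (𝓞 K) → ℕ} {𝔪 : Ideal (𝓞 K)}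
  {v : HeightOneSpectrum (𝓞 K)} [v.asIdeal.LiesOver (ratPlace p).asIdeal]

/-- `padicIntCast ℂ_[p] z = ((ι_{ℚ̄_p} z : ℚ̄_p) : ℂ_p)` (the scalar tower `ℚ_p ⊆ ℚ̄_p ⊆ ℂ_p`).
[cite: deShalit1987, I.3.1 (p. 13)] -/
theorem padicIntCast_padicComplex_eq_coe (z : ℤ_[p]) :
    padicIntCast ℂ_[p] z = ((algebraMap ℚ_[p] (PadicAlgCl p) (z : ℚ_[p]) : PadicAlgCl p) : ℂ_[p]) := by
  rw [padicIntCast_apply, PadicComplex.coe_eq, ← IsScalarTower.algebraMap_apply]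

/-- ★★ **The arithmetic half of (38) at a split place of degree one, in the lane's currency.** `K` totally
complex, `ε` of infinity type `(pp, qq)` with module of definition `(T, e) ≤ 𝔪`, `e` any avatar, `v` of
degree one over `p` (`e = f = 1`), `v ∤ 𝔪`, `w_𝔪 = 1`, `𝔪` deep enough at the other places above `p`
(`hdeep`), and `v` THE place of `ι⁻¹ ∘ σ_{w₀}` (the frame hypothesis `∀ d, d ∈ v ↔ ‖ι⁻¹(σ_{w₀} d)‖ < 1`).
Then for every `σ ∈ Gal(K̄/K(𝔪))`, with `κ = rayAdicCharacter h𝔪 hv hw` and `e_p = padicIntEquivOfDegreeOne`,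

  `‖ε̂(σ) − padicIntCast ℂ_[p] (e_p (κσ)) ^ (pp w₀)‖ ≤ p^{−N}`.

[cite: deShalit1987, II.4.14 (38) (p. 72), II.4.13 (p. 69)] [cite: SerreAbelianLadic1968, Ch. III §2.3] -/
theorem norm_avatarValueAt_sub_padicIntCast_zpow_le (ι : PadicAlgCl p ≃+* ℂ)
    (hinf : ε.HasInfinityType pp qq) (hmod : ε.IsModulus T em)
    {e : FramedGaloisRep K (PadicAlgCl p) 1} (hav : IsPAdicAvatarOf ι ε e)
    (hle : ∀ w ∈ T, (em w : ℤ) ≤ FractionalIdeal.count K w (𝔪 : FractionalIdeal (𝓞 K)⁰ K))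
    (h𝔪 : 𝔪 ≠ ⊥) (hv : ¬ 𝔪 ≤ v.asIdeal) (hw : ∀ u : (𝓞 K)ˣ, (u : 𝓞 K) - 1 ∈ 𝔪 → u = 1)
    (he : v.asIdeal.ramificationIdx (𝓞 ℚ) = 1) (hf : v.asIdeal.inertiaDeg (𝓞 ℚ) = 1)
    (hvp : ((p : ℕ) : 𝓞 K) ∈ v.asIdeal) {w₀ : InfinitePlace K}
    (hιv : ∀ d : 𝓞 K, d ∈ v.asIdeal ↔ ‖ι.symm (w₀.embedding (d : K))‖ < 1) {N : ℕ}
    (hdeep : ∀ w : HeightOneSpectrum (𝓞 K), ((p : ℕ) : 𝓞 K) ∈ w.asIdeal → w ≠ v →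
      WithZero.exp (-FractionalIdeal.count K w (𝔪 : FractionalIdeal (𝓞 K)⁰ K)) ≤
        Valued.v (algebraMap K (w.adicCompletion K) ((p : K) ^ N)))
    {σ : absoluteGaloisGroup K} (hσ : σ ∈ (absRestrictNormalHom (rayClassField K 𝔪)).ker) :
    ‖avatarValueAt e σ -
        padicIntCast ℂ_[p] (padicIntEquivOfDegreeOne K p v he hf
          (rayAdicCharacter h𝔪 hv hw ⟨σ, hσ⟩ : v.adicCompletionIntegers K)) ^ (pp w₀)‖ ≤ ((p : ℝ)⁻¹) ^ N := by
  have h := norm_avatarValueAt_sub_algPart_inv_localUnits_le ι hinf hmod hav hle h𝔪 hv hw hdeep ⟨σ, hσ⟩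
  rw [coe_algPart_inv_localUnits_of_degree_one ι pp qq he hf hvp, embExponent_eq_of_place ι pp qq he hf _ hιv,
    embExponent_embedding] at h
  rw [padicIntCast_padicComplex_eq_coe, PadicComplex.coe_eq]
  rw [PadicComplex.coe_eq, map_zpow₀] at h
  exact h

/-- ★★ **`AvatarMonomialCongruence`-shape: ONE constant for a whole family of moduli.** Along a family
`𝔪_M` (e.g. `𝔪_M = 𝔤·v̄^{M+1}`, de Shalit's `𝔣𝔭̄^{M+1}`) which is deep enough at the other places above `p`
at depth `p^{M+1}` (`hdeep`) and eventually (`M ≥ M₀`) divisible by the module of definition of `ε`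
(`hle`), there is `C ≥ 0` — here `C = 2·p^{M₀}` — with

  `‖ε̂(σ) − padicIntCast ℂ_[p] (e_p (κ_M σ)) ^ (pp w₀)‖ ≤ C · p^{−M}` for ALL `M` and all `σ ∈ Gal(K̄/K(𝔪_M))`

(for `M < M₀` the trivial bound `2`). This is the `∃ C ∀ M ∀ y ∈ U₀^{(M)}` clause of the R220-CUT's
`AvatarMonomialCongruence` for one in-range `ε`, with `mono e M = (e_p ∘ κ_M)^{pp w₀}` read in `ℂ_p`.
[cite: deShalit1987, II.4.14 (38) (p. 72)] -/
theorem exists_const_forall_norm_avatarValueAt_sub_le (ι : PadicAlgCl p ≃+* ℂ)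
    (hinf : ε.HasInfinityType pp qq) (hmod : ε.IsModulus T em)
    {e : FramedGaloisRep K (PadicAlgCl p) 1} (hav : IsPAdicAvatarOf ι ε e)
    (𝔪 : ℕ → Ideal (𝓞 K)) (h𝔪 : ∀ M, 𝔪 M ≠ ⊥) (hv : ∀ M, ¬ 𝔪 M ≤ v.asIdeal)
    (hw : ∀ M (u : (𝓞 K)ˣ), (u : 𝓞 K) - 1 ∈ 𝔪 M → u = 1)
    (he : v.asIdeal.ramificationIdx (𝓞 ℚ) = 1) (hf : v.asIdeal.inertiaDeg (𝓞 ℚ) = 1)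
    (hvp : ((p : ℕ) : 𝓞 K) ∈ v.asIdeal) {w₀ : InfinitePlace K}
    (hιv : ∀ d : 𝓞 K, d ∈ v.asIdeal ↔ ‖ι.symm (w₀.embedding (d : K))‖ < 1)
    (hdeep : ∀ (M : ℕ) (w : HeightOneSpectrum (𝓞 K)), ((p : ℕ) : 𝓞 K) ∈ w.asIdeal → w ≠ v →
      WithZero.exp (-FractionalIdeal.count K w (𝔪 M : FractionalIdeal (𝓞 K)⁰ K)) ≤
        Valued.v (algebraMap K (w.adicCompletion K) ((p : K) ^ (M + 1))))
    {M₀ : ℕ} (hle : ∀ M, M₀ ≤ M → ∀ w ∈ T, (em w : ℤ) ≤ FractionalIdeal.count K w (𝔪 M : FractionalIdeal (𝓞 K)⁰ K)) :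
    ∃ C : ℝ, 0 ≤ C ∧ ∀ (M : ℕ) (σ : absoluteGaloisGroup K)
      (hσ : σ ∈ (absRestrictNormalHom (rayClassField K (𝔪 M))).ker),
      ‖avatarValueAt e σ -
          padicIntCast ℂ_[p] (padicIntEquivOfDegreeOne K p v he hf
            (rayAdicCharacter (h𝔪 M) (hv M) (hw M) ⟨σ, hσ⟩ : v.adicCompletionIntegers K)) ^ (pp w₀)‖ ≤
        C * ((p : ℝ)⁻¹) ^ M := by
  have hp1 : (1 : ℝ) ≤ p := by exact_mod_cast (Fact.out : p.Prime).one_lt.le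
  have hp0 : (0 : ℝ) < p := by positivity
  refine ⟨2 * (p : ℝ) ^ M₀, by positivity, fun M σ hσ => ?_⟩
  by_cases hM : M₀ ≤ M
  · have h := norm_avatarValueAt_sub_padicIntCast_zpow_le ι hinf hmod hav (hle M hM) (h𝔪 M) (hv M) (hw M)
      he hf hvp hιv (hdeep M) hσ
    refine h.trans ?_
    have h1 : ((p : ℝ)⁻¹) ^ (M + 1) ≤ ((p : ℝ)⁻¹) ^ M :=
      pow_le_pow_of_le_one (by positivity) (inv_le_one_of_one_le₀ hp1) (Nat.le_succ M)
    have h2 : (1 : ℝ) ≤ 2 * (p : ℝ) ^ M₀ := by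
      have := one_le_pow₀ (M₀ := ℝ) hp1 (n := M₀)
      linarith
    calc ((p : ℝ)⁻¹) ^ (M + 1) ≤ 1 * ((p : ℝ)⁻¹) ^ M := by rw [one_mul]; exact h1
      _ ≤ 2 * (p : ℝ) ^ M₀ * ((p : ℝ)⁻¹) ^ M := by gcongr
  · -- trivial bound `2` for `M < M₀`
    rw [not_le] at hM
    have hu : ‖padicIntCast ℂ_[p] (padicIntEquivOfDegreeOne K p v he hf
        (rayAdicCharacter (h𝔪 M) (hv M) (hw M) ⟨σ, hσ⟩ : v.adicCompletionIntegers K)) ^ (pp w₀)‖ = 1 := by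
      rw [norm_zpow, norm_padicIntCast, PadicInt.isUnit_iff.mp ((Units.isUnit _).map _), one_zpow]
    have hle2 : ‖avatarValueAt e σ -
        padicIntCast ℂ_[p] (padicIntEquivOfDegreeOne K p v he hf
          (rayAdicCharacter (h𝔪 M) (hv M) (hw M) ⟨σ, hσ⟩ : v.adicCompletionIntegers K)) ^ (pp w₀)‖ ≤ 2 :=
      (norm_sub_le _ _).trans (by rw [norm_avatarValueAt_eq_one, hu]; norm_num)
    refine hle2.trans ?_
    -- `2 ≤ 2 p^{M₀} p^{-M}` since `M < M₀`
    have h3 : (1 : ℝ) ≤ (p : ℝ) ^ M₀ * ((p : ℝ)⁻¹) ^ M := by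
      rw [inv_pow, ← div_eq_mul_inv, one_le_div (pow_pos hp0 M)]
      exact pow_le_pow_right₀ hp1 hM.le
    calc (2 : ℝ) = 2 * 1 := (mul_one _).symm
      _ ≤ 2 * ((p : ℝ) ^ M₀ * ((p : ℝ)⁻¹) ^ M) := by gcongr
      _ = 2 * (p : ℝ) ^ M₀ * ((p : ℝ)⁻¹) ^ M := by ring

end Lane

end Summit.BirchSwinnertonDyer.BirchSwinnertonDyer.Theorems.PrintCf2.AvatarOnRay

end
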